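import Mathlib
import Summits.ResolutionOfSingularities.ResolutionOfSingularities.Theorems.WildQuotientsWildQuotientResolutionLinearCharThreeOfV3

/-!
# Every LINEAR `σ` on `𝔸ⁿ`, `n ≤ 4`, with `(σ − 1)³ = 0` has a resolvable quotient — given the `J₃` rung (any characteristic)

(crux stmt-ResolutionOfSingularities-15640 `WildQuotients.WildQuotientResolution`, line `Sketch`,
sector `|G| = p`; programme V3U of `L/w45c/CHAIN.md` v5 (plan-1 RULING pre-CHAIN-v5
2026-08-27T01:38:23Z, row stub-4): the characteristic-free form of
`LinearCubeZero.linearCyclicQuotient_hasResolution_charThree_of_v3` (p480877) — the `J₃` rung is the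
hypothesis `hJ3` (to be discharged by V3 at `p = 3` and by the toric exit V3U at every `p ≥ 3`),
`(σ − 1)³ = 0` is the hypothesis `hcube` (instead of `σ³ = 1` + `char k = 3`). [OURS · L1 W4.5c] —
NOT a statement of any manuscript; replaces the role of no printed item. Prover res-L1-w45c-stub-4.)
-/

-- single-problem summit: the doubled namespace component `ResolutionOfSingularities` is forced
set_option linter.dupNamespace false

noncomputable section

open Module MvPolynomial AlgebraicGeometry CategoryTheory Literature.AlgebraicGeometry.Resolution

namespace Summit.ResolutionOfSingularities.ResolutionOfSingularities.Theorems.WildQuotientResolution.LinearCubeZero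

/-- **Linear `σ` with `(σ − 1)³ = 0` on `𝔸ⁿ`, `n ≤ 4`, modulo the `J₃` rung** (any prime
characteristic `p`): by JNF-3 (`exists_conj_normalForm_of_cube_zero`, p479366) `σ` is conjugate to
an LSB datum — resolved by `LinearSmallBlocks.hasResolution` (p471938) — or to a `J₃`-with-passengers
datum — resolved by the hypothesis `hJ3` —, and `TameTransfer.hasResolution_fixedPoints_zpowers_conj`
(p471072) transports the resolution back along the conjugation. [OURS · L1 W4.5c] -/
theorem linearCyclicQuotient_hasResolution_of_cube_zero_of_jordanThree (p : ℕ) (hp : p.Prime)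
    (k : Type) [Field k] [CharP k p]
    (hJ3 : ∀ (n : ℕ) (σ : MvPolynomial (Fin n) k ≃ₐ[k] MvPolynomial (Fin n) k) (a b c : Fin n),
      a ≠ b → b ≠ c → a ≠ c → σ (X b) = X b + X a → σ (X c) = X c + X b →
      (∀ i, i ≠ b → i ≠ c → σ (X i) = X i) →
      Scheme.HasResolution
        (Spec (.of (FixedPoints.subalgebra k (MvPolynomial (Fin n) k) (Subgroup.zpowers σ)))))
    (n : ℕ) (hn : n ≤ 4) (σ : MvPolynomial (Fin n) k ≃ₐ[k] MvPolynomial (Fin n) k)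
    (hlin : ∀ i, σ (X i) ∈ Submodule.span k (Set.range (X : Fin n → MvPolynomial (Fin n) k)))
    (hcube : ∀ i, σ (σ (σ (X i) - X i) - (σ (X i) - X i)) = σ (σ (X i) - X i) - (σ (X i) - X i)) :
    Scheme.HasResolution
      (Spec (.of (FixedPoints.subalgebra k (MvPolynomial (Fin n) k) (Subgroup.zpowers σ)))) := by
  obtain ⟨τ, h⟩ := exists_conj_normalForm_of_cube_zero k n hn σ hlin hcube
  have e : τ⁻¹ * (τ * σ * τ⁻¹) * τ⁻¹⁻¹ = σ := by group
  rcases h with ⟨D, f, hfD, hD, hoff⟩ | ⟨a, b, c, hab, hbc, hac, hb, hc, hrest⟩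
  · have h := LinearSmallBlocks.hasResolution p hp k n (τ * σ * τ⁻¹) D f hfD hD hoff
    have h' := TameTransfer.hasResolution_fixedPoints_zpowers_conj (τ * σ * τ⁻¹) τ⁻¹ h
    rw [e] at h'
    exact h'
  · have h := hJ3 n (τ * σ * τ⁻¹) a b c hab hbc hac hb hc hrest
    have h' := TameTransfer.hasResolution_fixedPoints_zpowers_conj (τ * σ * τ⁻¹) τ⁻¹ h
    rw [e] at h'
    exact h'

end Summit.ResolutionOfSingularities.ResolutionOfSingularities.Theorems.WildQuotientResolution.LinearCubeZero

end
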